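import Mathlib.Analysis.SpecialFunctions.Log.Deriv
import Mathlib.Analysis.Convex.SpecificFunctions.Basic
import Mathlib.Analysis.Calculus.MeanValue
import Summits.CriticalPhenomena.PercolationContinuityZ3.Theorems.PercNearOneGluingNoHeavyLowerTailGZSP
import HarnessLib

/-!
# `NoHeavyLowerTail` (stmt-CriticalPhenomena-4575) — support file: the PENDANT-HUB step of the logarithmic covariance
# bound (prover `prim-ineq-prove-2` gen 13; memo `run/shared/lean/prim/prim-ineq-prove-2/MEMO-22-RAY-MONOTONICITY.md` §3)

No definitions, no named facts, no sorries.  Cell-level (real-arithmetic) step.  Setting of the memo: a hub `c` joined to a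
single vertex `u` of a two-terminal network `(E; a, b)` by an edge of weight `γ`.  With `θ = P(a ↔ b)`, `W = P(a ↔ b, u ∉ C)`
(`= P(ab|u)`), `τ = θ − W = P(a ↔ u ↔ b)`, `C = Cov(1{a ↔ u}, 1{b ↔ u})` and `Θ = P(a ↔ b off u) ∈ [W, θ]`, the new network has
`Cov' = γ(1−γ)τ + γ²C`, `w' = θ − γτ`, `θ' = θ`; so the logarithmic covariance bound passes from the glued network
(`C ≤ W log(Θ/W)`, e.g. THEOREM SP for the network with hub `u`) to the pendant-hub network for EVERY `γ ∈ [0, 1]`: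

* `GZPendantHub.hasDerivAt_psi` — derivative of `ψ(y) = y + (1 − y) log (1 − y)` is `−log (1 − y)`;
* `GZPendantHub.mul_log_one_sub_le` — concavity: `γ · log (1 − x) ≤ log (1 − γ x)`;
* `GZPendantHub.psi_mul_le` — **two-superhomogeneity** `ψ(γ x) ≤ γ² ψ(x)` (`0 ≤ γ ≤ 1`, `0 ≤ x < 1`), i.e. ray monotonicity of
  `Φ(γ)/γ²` for a single hub vertex;
* `GZPendantHub.pendant_of_facts` — the step: `C ≤ W·log(Θ/W)`, `0 < W ≤ Θ ≤ θ`, `τ = θ − W`, `0 ≤ γ ≤ 1` imply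
  `γ(1−γ)τ + γ²C ≤ (θ − γτ)·log(θ/(θ − γτ))`;
* `GZPendantHub.reachable_pendant_iff`, `inter_insert_diff_hub` — graph facts for a pendant vertex;
* `GZPendantHub.pendant_cov_le` — **measure level**: for `GZSP.IsSPNet u E a b` (weights in `(0,1)`) and a vertex `c`
  off `E` joined to `u` by one edge of any weight, the network `E ∪ {uc}` with hub `c` satisfies
  `P(a↮c, b↮c) − P(a↮c)P(b↮c) ≤ P(ab|c)·log(P(a ↔ b off c)/P(ab|c))` — the first instances of the logarithmic
  covariance bound whose `a–b` core off the hub is NOT series–parallel (bridge / `K₄` with one hub edge).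
-/

noncomputable section

namespace Summit.CriticalPhenomena.PercolationContinuityZ3.Theorems

namespace GZPendantHub

open Real Set

/-- The function `ψ(y) = y + (1 − y) log(1 − y)` has derivative `−log(1 − y)` at every `y < 1`. [folklore] -/
theorem hasDerivAt_psi {y : ℝ} (hy : y < 1) :
    HasDerivAt (fun y : ℝ => y + (1 - y) * Real.log (1 - y)) (-Real.log (1 - y)) y := by
  have hne : (1 - y) ≠ 0 := by linarith
  have h1 : HasDerivAt (fun y : ℝ => 1 - y) (-1) y := by
    have := (hasDerivAt_id y).const_sub (1 : ℝ)
    simpa using this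
  have hlog : HasDerivAt (fun y : ℝ => Real.log (1 - y)) ((1 - y)⁻¹ * (-1)) y :=
    (Real.hasDerivAt_log hne).comp y h1
  have h := (hasDerivAt_id' y).add (h1.mul hlog)
  refine h.congr_deriv ?_
  have e : (1 - y) * ((1 - y)⁻¹ * (-1 : ℝ)) = -1 := by
    rw [← mul_assoc, mul_inv_cancel₀ hne]; ring
  rw [e]; ring

/-- Concavity of the logarithm between `1` and `1 − x`: `γ · log(1 − x) ≤ log(1 − γ x)` for `0 ≤ γ ≤ 1`, `x < 1`.
[folklore] -/
theorem mul_log_one_sub_le {γ x : ℝ} (hγ0 : 0 ≤ γ) (hγ1 : γ ≤ 1) (hx : x < 1) :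
    γ * Real.log (1 - x) ≤ Real.log (1 - γ * x) := by
  have hconc := strictConcaveOn_log_Ioi.concaveOn
  have h := hconc.2 (show (1 : ℝ) ∈ Ioi 0 by simp only [mem_Ioi]; exact zero_lt_one)
    (show (1 - x) ∈ Ioi 0 by simp only [mem_Ioi]; linarith) (show 0 ≤ 1 - γ by linarith) hγ0 (by ring)
  simp only [smul_eq_mul, Real.log_one, mul_zero, zero_add, mul_one] at h
  have e : 1 - γ + γ * (1 - x) = 1 - γ * x := by ring
  rw [e] at h
  exact h

/-- **Two-superhomogeneity of `ψ(y) = y + (1 − y) log(1 − y)`**: `ψ(γ x) ≤ γ² ψ(x)` for `0 ≤ γ ≤ 1`, `0 ≤ x < 1`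
(equivalently `ψ(γx)/γ²` is non-decreasing in `γ`; `ψ = Σ_{k≥2} y^k/(k(k−1))`).  Proof: `D(y) = γ²ψ(y) − ψ(γy)` has
`D(0) = 0` and `D'(y) = γ(log(1 − γy) − γ log(1 − y)) ≥ 0` by concavity of `log`. [folklore] -/
theorem psi_mul_le {γ x : ℝ} (hγ0 : 0 ≤ γ) (hγ1 : γ ≤ 1) (hx0 : 0 ≤ x) (hx1 : x < 1) :
    γ * x + (1 - γ * x) * Real.log (1 - γ * x) ≤ γ ^ 2 * (x + (1 - x) * Real.log (1 - x)) := by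
  -- D(y) := γ² ψ(y) − ψ(γ y) is monotone on [0, x]
  set D : ℝ → ℝ := fun y => γ ^ 2 * (y + (1 - y) * Real.log (1 - y)) -
    (γ * y + (1 - γ * y) * Real.log (1 - γ * y)) with hD
  have hderiv : ∀ y ∈ Icc 0 x, HasDerivAt D (γ ^ 2 * (-Real.log (1 - y)) - (-Real.log (1 - γ * y) * (γ * 1))) y := by
    intro y hy
    have hy1 : y < 1 := lt_of_le_of_lt hy.2 hx1
    have hγy : γ * y < 1 := by
      rcases eq_or_lt_of_le hy.1 with h | h
      · rw [← h]; simp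
      · calc γ * y ≤ 1 * y := mul_le_mul_of_nonneg_right hγ1 h.le
          _ = y := one_mul y
          _ < 1 := hy1
    have h2 : HasDerivAt (fun y : ℝ => γ * y + (1 - γ * y) * Real.log (1 - γ * y))
        (-Real.log (1 - γ * y) * (γ * 1)) y := by
      have hc : HasDerivAt (fun y : ℝ => γ * y) (γ * 1) y := (hasDerivAt_id y).const_mul γ
      exact (hasDerivAt_psi hγy).comp y hc
    exact ((hasDerivAt_psi hy1).const_mul (γ ^ 2)).sub h2
  have hmono : MonotoneOn D (Icc 0 x) := by
    refine monotoneOn_of_deriv_nonneg (convex_Icc 0 x) ?_ ?_ ?_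
    · exact fun y hy => (hderiv y hy).continuousAt.continuousWithinAt
    · intro y hy
      rw [interior_Icc] at hy
      exact (hderiv y (Ioo_subset_Icc_self hy)).differentiableAt.differentiableWithinAt
    · intro y hy
      rw [interior_Icc] at hy
      rw [(hderiv y (Ioo_subset_Icc_self hy)).deriv]
      have hy1 : y < 1 := lt_trans hy.2 hx1
      have hconc := mul_log_one_sub_le hγ0 hγ1 hy1
      have : 0 ≤ γ * (Real.log (1 - γ * y) - γ * Real.log (1 - y)) := mul_nonneg hγ0 (by linarith)
      nlinarith
  have h := hmono (left_mem_Icc.2 hx0) (right_mem_Icc.2 hx0) hx0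
  simp only [hD, mul_zero, sub_zero, Real.log_one, add_zero] at h
  linarith

/-- **The pendant-hub step** (cell level).  If the glued network satisfies the logarithmic covariance bound
`C ≤ W·log(Θ/W)` with `0 < W ≤ Θ ≤ θ` and `τ = θ − W`, then for every hub weight `0 ≤ γ ≤ 1` the pendant-hub network does:
`γ(1 − γ)τ + γ²C ≤ (θ − γτ)·log(θ/(θ − γτ))` (its covariance is `γ(1−γ)τ + γ²C`, its `P(ab|c)` is `θ − γτ`, its
`P(a ↔ b off c)` is `θ`).  MEMO-22 §3. [folklore; this work] -/
theorem pendant_of_facts {θ Θ W C τ γ : ℝ} (hW : 0 < W) (hWΘ : W ≤ Θ) (hΘθ : Θ ≤ θ) (hτ : τ = θ - W)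
    (hγ0 : 0 ≤ γ) (hγ1 : γ ≤ 1) (L : C ≤ W * Real.log (Θ / W)) :
    γ * (1 - γ) * τ + γ ^ 2 * C ≤ (θ - γ * τ) * Real.log (θ / (θ - γ * τ)) := by
  have hΘ : 0 < Θ := lt_of_lt_of_le hW hWΘ
  have hθ : 0 < θ := lt_of_lt_of_le hΘ hΘθ
  have hWθ : W ≤ θ := hWΘ.trans hΘθ
  -- weaken the hypothesis to `Θ := θ`
  have L' : C ≤ W * Real.log (θ / W) :=
    L.trans (mul_le_mul_of_nonneg_left
      (Real.log_le_log (div_pos hΘ hW) (div_le_div_of_nonneg_right hΘθ hW.le)) hW.le)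
  -- normalised variable x = τ/θ ∈ [0, 1)
  set x : ℝ := τ / θ with hx
  have hx0 : 0 ≤ x := div_nonneg (by rw [hτ]; linarith) hθ.le
  have hx1 : x < 1 := by rw [hx, div_lt_one hθ, hτ]; linarith
  have key := psi_mul_le hγ0 hγ1 hx0 hx1
  -- translate back: θ·x = τ, θ(1 − x) = W, θ(1 − γx) = θ − γτ
  have hτx : τ = θ * x := by rw [hx]; field_simp
  have hWx : W = θ * (1 - x) := by rw [hτx] at hτ; linarith
  have hw' : θ - γ * τ = θ * (1 - γ * x) := by rw [hτx]; ring
  have h1x : 0 < 1 - x := by linarith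
  have h1γx : 0 < 1 - γ * x := by nlinarith
  have hlog1 : Real.log (1 - x) = -Real.log (θ / W) := by
    rw [hWx, show θ / (θ * (1 - x)) = (1 - x)⁻¹ by field_simp, Real.log_inv, neg_neg]
  have hlog2 : Real.log (1 - γ * x) = -Real.log (θ / (θ - γ * τ)) := by
    rw [hw', show θ / (θ * (1 - γ * x)) = (1 - γ * x)⁻¹ by field_simp, Real.log_inv, neg_neg]
  rw [hlog1, hlog2] at key
  -- key : γx − (1 − γx)·log(θ/(θ−γτ)) ≤ γ²(x − (1 − x)·log(θ/W)); multiply by θ > 0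
  have key' := mul_le_mul_of_nonneg_left key hθ.le
  have e1 : θ * (γ * x + (1 - γ * x) * -Real.log (θ / (θ - γ * τ))) =
      γ * τ - (θ - γ * τ) * Real.log (θ / (θ - γ * τ)) := by rw [hw', hτx]; ring
  have e2 : θ * (γ ^ 2 * (x + (1 - x) * -Real.log (θ / W))) =
      γ ^ 2 * τ - γ ^ 2 * (W * Real.log (θ / W)) := by rw [hWx, hτx]; ring
  rw [e1, e2] at key'
  have hγ2 : 0 ≤ γ ^ 2 := sq_nonneg γ
  nlinarith [mul_le_mul_of_nonneg_left L' hγ2]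

/-! ### Graph facts for a pendant hub -/

section pendant

variable {V : Type*}

open Literature.Probability.Percolation
open scoped Classical

/-- **Reaching a pendant vertex.**  If `c` lies on no edge of `E`, `x ≠ c`, `u ≠ c`, then in a configuration read on
`ω ∩ (E ∪ {uc})` the vertex `x` is joined to `c` iff the edge `uc` is present and `x` is joined to `u` inside `ω ∩ E`.
[folklore] -/
theorem reachable_pendant_iff (ω : Set (Sym2 V)) {E : Finset (Sym2 V)} {u c x : V}
    (hcE : ∀ e ∈ E, c ∉ e) (hxc : x ≠ c) (huc : u ≠ c) :
    (openGraph (ω ∩ (↑(insert s(u, c) E) : Set (Sym2 V)))).Reachable x c ↔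
      (s(u, c) ∈ ω ∧ (openGraph (ω ∩ (↑E : Set (Sym2 V)))).Reachable x u) := by
  constructor
  · rintro ⟨p⟩
    suffices H : ∀ {x : V} (_ : (openGraph (ω ∩ (↑(insert s(u, c) E) : Set (Sym2 V)))).Walk x c), x ≠ c →
        (s(u, c) ∈ ω ∧ (openGraph (ω ∩ (↑E : Set (Sym2 V)))).Reachable x u) from H p hxc
    intro x q
    -- generalise the end point to run the induction
    suffices H' : ∀ {x y : V} (_ : (openGraph (ω ∩ (↑(insert s(u, c) E) : Set (Sym2 V)))).Walk x y), y = c → x ≠ c →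
        (s(u, c) ∈ ω ∧ (openGraph (ω ∩ (↑E : Set (Sym2 V)))).Reachable x u) from H' q rfl
    intro x y q
    induction q with
    | nil => intro h1 h2; exact absurd h1 h2
    | @cons x y z hadj q ih =>
      intro hzc hxc'
      rw [openGraph_adj] at hadj
      obtain ⟨⟨hω, hE'⟩, hxy⟩ := hadj
      rw [Finset.coe_insert, Set.mem_insert_iff] at hE'
      by_cases hyc : y = c
      · -- the last edge is the pendant edge, so x = u
        subst hyc
        rcases hE' with he | he
        · rcases Sym2.eq_iff.1 he with ⟨hxu, -⟩ | ⟨hxc'', -⟩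
          · subst hxu; exact ⟨he ▸ hω, SimpleGraph.Reachable.refl _⟩
          · exact absurd hxc'' hxc'
        · exact absurd (Sym2.mem_mk_right x y) (hcE _ he)
      · obtain ⟨hωuc, hyu⟩ := ih hzc hyc
        refine ⟨hωuc, ?_⟩
        rcases hE' with he | he
        · exfalso
          rcases Sym2.eq_iff.1 he with ⟨-, h2⟩ | ⟨h1, -⟩
          · exact hyc h2
          · exact hxc' h1
        · have hadj' : (openGraph (ω ∩ (↑E : Set (Sym2 V)))).Adj x y := by
            rw [openGraph_adj]; exact ⟨⟨hω, he⟩, hxy⟩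
          exact hadj'.reachable.trans hyu
  · rintro ⟨hωuc, hxu⟩
    have h1 : (openGraph (ω ∩ (↑(insert s(u, c) E) : Set (Sym2 V)))).Reachable x u :=
      hxu.mono (openGraph_mono (Set.inter_subset_inter_right ω (by
        rw [Finset.coe_insert]; exact Set.subset_insert _ _)))
    have h2 : (openGraph (ω ∩ (↑(insert s(u, c) E) : Set (Sym2 V)))).Adj u c := by
      rw [openGraph_adj]
      exact ⟨⟨hωuc, by rw [Finset.coe_insert]; exact Set.mem_insert _ _⟩, huc⟩
    exact h1.trans h2.reachable

/-- Removing the pairs at the pendant hub `c` from `ω ∩ (E ∪ {uc})` leaves `ω ∩ E`. [folklore] -/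
theorem inter_insert_diff_hub (ω : Set (Sym2 V)) {E : Finset (Sym2 V)} {u c : V} (hcE : ∀ e ∈ E, c ∉ e) :
    (ω ∩ (↑(insert s(u, c) E) : Set (Sym2 V))) \ {e : Sym2 V | c ∈ e} = ω ∩ (↑E : Set (Sym2 V)) := by
  ext e
  simp only [Finset.coe_insert, Set.mem_sdiff, Set.mem_inter_iff, Set.mem_insert_iff, Finset.mem_coe,
    Set.mem_setOf_eq]
  constructor
  · rintro ⟨⟨hω, h | h⟩, hc⟩
    · exact absurd (h ▸ Sym2.mem_mk_right u c) hc
    · exact ⟨hω, h⟩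
  · rintro ⟨hω, h⟩
    exact ⟨⟨hω, Or.inr h⟩, hcE e h⟩

end pendant

/-! ### The pendant-hub network under `prodBernoulli` -/

section measure

variable {V : Type*} [Fintype V]

open MeasureTheory Literature.Probability.LatticeModels Literature.Probability.Percolation
open scoped Classical

/-- **L-log for a pendant hub over a series–parallel network** (first non-series–parallel cores).  Let `E` be a
two-terminal series–parallel hub network with terminals `a, b` and hub `u` (`GZSP.IsSPNet u E a b`), weights in `(0,1)`
on `E`, and let `c` be a vertex on no edge of `E`, joined to `u` by the single edge `uc` (any weight in `[0,1]`).  Then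
for the network `E ∪ {uc}` with hub `c`:
`P(a↮c, b↮c) − P(a↮c)·P(b↮c) ≤ P(ab|c) · log (P(a ↔ b off c) / P(ab|c))`.
Examples: the Wheatstone bridge with the hub joined to one internal vertex, `K₄` with the hub joined to one vertex.
Proof: `Cov' = γ(1−γ)τ + γ²C`, `w' = θ − γτ`, `θ' = θ` and `GZPendantHub.pendant_of_facts` on top of THEOREM SP
(`GZSP.sp_facts`) for `E` with hub `u`.  MEMO-22 §3. [folklore; this work] -/
theorem pendant_cov_le (w : Sym2 V → unitInterval) {u c : V} {E : Finset (Sym2 V)} {a b : V}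
    (h : GZSP.IsSPNet u E a b) (hcE : ∀ e ∈ E, c ∉ e) (hac : a ≠ c) (hbc : b ≠ c) (huc : u ≠ c)
    (hw : ∀ e ∈ E, 0 < (w e : ℝ) ∧ (w e : ℝ) < 1) :
    (prodBernoulli w).real ({ω : Set (Sym2 V) | ¬(openGraph (ω ∩ (↑(insert s(u, c) E) : Set (Sym2 V)))).Reachable a c} ∩ {ω : Set (Sym2 V) | ¬(openGraph (ω ∩ (↑(insert s(u, c) E) : Set (Sym2 V)))).Reachable b c}) -
        (prodBernoulli w).real {ω : Set (Sym2 V) | ¬(openGraph (ω ∩ (↑(insert s(u, c) E) : Set (Sym2 V)))).Reachable a c} *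
          (prodBernoulli w).real {ω : Set (Sym2 V) | ¬(openGraph (ω ∩ (↑(insert s(u, c) E) : Set (Sym2 V)))).Reachable b c} ≤
      ((prodBernoulli w).real ({ω : Set (Sym2 V) | ¬(openGraph (ω ∩ (↑(insert s(u, c) E) : Set (Sym2 V)))).Reachable a c} ∩ {ω : Set (Sym2 V) | ¬(openGraph (ω ∩ (↑(insert s(u, c) E) : Set (Sym2 V)))).Reachable b c}) -
          (prodBernoulli w).real ({ω : Set (Sym2 V) | ¬(openGraph (ω ∩ (↑(insert s(u, c) E) : Set (Sym2 V)))).Reachable a b} ∩ {ω : Set (Sym2 V) | ¬(openGraph (ω ∩ (↑(insert s(u, c) E) : Set (Sym2 V)))).Reachable a c} ∩ {ω : Set (Sym2 V) | ¬(openGraph (ω ∩ (↑(insert s(u, c) E) : Set (Sym2 V)))).Reachable b c})) *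
        Real.log ((prodBernoulli w).real {ω : Set (Sym2 V) | (openGraph ((ω ∩ (↑(insert s(u, c) E) : Set (Sym2 V))) \ {e : Sym2 V | c ∈ e})).Reachable a b} /
          ((prodBernoulli w).real ({ω : Set (Sym2 V) | ¬(openGraph (ω ∩ (↑(insert s(u, c) E) : Set (Sym2 V)))).Reachable a c} ∩ {ω : Set (Sym2 V) | ¬(openGraph (ω ∩ (↑(insert s(u, c) E) : Set (Sym2 V)))).Reachable b c}) -
            (prodBernoulli w).real ({ω : Set (Sym2 V) | ¬(openGraph (ω ∩ (↑(insert s(u, c) E) : Set (Sym2 V)))).Reachable a b} ∩ {ω : Set (Sym2 V) | ¬(openGraph (ω ∩ (↑(insert s(u, c) E) : Set (Sym2 V)))).Reachable a c} ∩ {ω : Set (Sym2 V) | ¬(openGraph (ω ∩ (↑(insert s(u, c) E) : Set (Sym2 V)))).Reachable b c}))) := by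
  obtain ⟨hab, hau, hbu⟩ := h.terminals_ne
  set μ := prodBernoulli w with hμ
  set γ : ℝ := (w s(u, c) : ℝ) with hγ
  have hγ0 : 0 ≤ γ := (w s(u, c)).2.1
  have hγ1 : γ ≤ 1 := (w s(u, c)).2.2
  have hm : ∀ S : Set (Set (Sym2 V)), MeasurableSet S := fun S => MeasurableSet.of_discrete
  -- events of the glued network `(E; a, b)` with hub `u`
  set Au : Set (Set (Sym2 V)) := {ω | ¬(openGraph (ω ∩ (↑E : Set (Sym2 V)))).Reachable a u} with hAu
  set Bu : Set (Set (Sym2 V)) := {ω | ¬(openGraph (ω ∩ (↑E : Set (Sym2 V)))).Reachable b u} with hBu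
  set D : Set (Set (Sym2 V)) := {ω | ¬(openGraph (ω ∩ (↑E : Set (Sym2 V)))).Reachable a b} with hD
  set Tu : Set (Set (Sym2 V)) := {ω | (openGraph ((ω ∩ (↑E : Set (Sym2 V))) \ {e : Sym2 V | u ∈ e})).Reachable a b}
    with hTu
  -- the pendant coordinate
  set H : Set (Set (Sym2 V)) := {ω | s(u, c) ∈ ω} with hH
  -- events of the pendant-hub network
  have hA' : {ω : Set (Sym2 V) | ¬(openGraph (ω ∩ (↑(insert s(u, c) E) : Set (Sym2 V)))).Reachable a c} = Hᶜ ∪ Au := by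
    ext ω
    simp only [Set.mem_setOf_eq, Set.mem_union, Set.mem_compl_iff, hH, hAu]
    rw [reachable_pendant_iff ω hcE hac huc, not_and_or]
  have hB' : {ω : Set (Sym2 V) | ¬(openGraph (ω ∩ (↑(insert s(u, c) E) : Set (Sym2 V)))).Reachable b c} = Hᶜ ∪ Bu := by
    ext ω
    simp only [Set.mem_setOf_eq, Set.mem_union, Set.mem_compl_iff, hH, hBu]
    rw [reachable_pendant_iff ω hcE hbc huc, not_and_or]
  have hT' : {ω : Set (Sym2 V) | (openGraph ((ω ∩ (↑(insert s(u, c) E) : Set (Sym2 V))) \ {e : Sym2 V | c ∈ e})).Reachable a b} = Dᶜ := by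
    ext ω
    simp only [Set.mem_setOf_eq, Set.mem_compl_iff, hD, not_not]
    rw [inter_insert_diff_hub ω hcE]
  have hN' : {ω : Set (Sym2 V) | ¬(openGraph (ω ∩ (↑(insert s(u, c) E) : Set (Sym2 V)))).Reachable a b} ∩
      {ω : Set (Sym2 V) | ¬(openGraph (ω ∩ (↑(insert s(u, c) E) : Set (Sym2 V)))).Reachable a c} ∩
      {ω : Set (Sym2 V) | ¬(openGraph (ω ∩ (↑(insert s(u, c) E) : Set (Sym2 V)))).Reachable b c} = D ∩ ((Hᶜ ∪ Au) ∩ (Hᶜ ∪ Bu)) := by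
    rw [Set.inter_assoc, hA', hB']
    ext ω
    simp only [Set.mem_inter_iff, Set.mem_setOf_eq, hD]
    constructor
    · rintro ⟨hD', hrest⟩
      refine ⟨fun hab' => hD' (hab'.mono (openGraph_mono (Set.inter_subset_inter_right ω (by
        rw [Finset.coe_insert]; exact Set.subset_insert _ _)))), hrest⟩
    · rintro ⟨hD', hrest⟩
      refine ⟨fun hab' => hD' ?_, hrest⟩
      have hac' : ¬(openGraph (ω ∩ (↑(insert s(u, c) E) : Set (Sym2 V)))).Reachable a c := by
        rw [← Set.mem_setOf_eq (p := fun ω => ¬(openGraph (ω ∩ (↑(insert s(u, c) E) : Set (Sym2 V)))).Reachable a c), hA']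
        exact hrest.1
      have := GZGluingLaw.reach_off_of_reach hab' hac'
      rwa [inter_insert_diff_hub ω hcE] at this
  -- independence of the pendant coordinate from the `E`-events
  have hsE : s(u, c) ∉ E := fun he => hcE _ he (Sym2.mem_mk_right u c)
  have hdisj : Disjoint E ({s(u, c)} : Finset (Sym2 V)) := Finset.disjoint_singleton_right.2 hsE
  have hHform : H = {ω : Set (Sym2 V) | s(u, c) ∈ ω ∩ (↑({s(u, c)} : Finset (Sym2 V)) : Set (Sym2 V))} := by
    ext ω; simp [hH]
  have hPH : μ.real H = γ := by rw [hH, hμ, prodBernoulli_real_setOf_mem]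
  have hPHc : μ.real Hᶜ = 1 - γ := by rw [probReal_compl_eq_one_sub (hm _), hPH]
  have indep : ∀ (Φ : Set (Sym2 V) → Prop), μ.real (H ∩ {ω | Φ (ω ∩ ↑E)}) = γ * μ.real {ω | Φ (ω ∩ ↑E)} := by
    intro Φ
    have := GZGluingLaw.real_inter_restrict w hdisj Φ (fun η => s(u, c) ∈ η)
    rw [Set.inter_comm, ← hHform] at this
    rw [hμ, this, ← hμ, hPH, mul_comm]
  -- `P(Hᶜ ∪ X) = (1 − γ) + γ P(X)` for an `E`-event `X`
  have split : ∀ (Φ : Set (Sym2 V) → Prop), μ.real (Hᶜ ∪ {ω | Φ (ω ∩ ↑E)}) = (1 - γ) + γ * μ.real {ω | Φ (ω ∩ ↑E)} := by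
    intro Φ
    have hdu : Hᶜ ∪ {ω | Φ (ω ∩ ↑E)} = Hᶜ ∪ (H ∩ {ω | Φ (ω ∩ ↑E)}) := by
      ext ω; simp only [Set.mem_union, Set.mem_compl_iff, Set.mem_inter_iff]; tauto
    have hdj : Disjoint Hᶜ (H ∩ {ω | Φ (ω ∩ ↑E)}) :=
      Set.disjoint_left.2 fun ω hω hω' => hω hω'.1
    rw [hdu, measureReal_union hdj (hm _), hPHc, indep]
  have splitD : ∀ (Φ : Set (Sym2 V) → Prop), μ.real (D ∩ (Hᶜ ∪ {ω | Φ (ω ∩ ↑E)})) =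
      (1 - γ) * μ.real D + γ * μ.real (D ∩ {ω | Φ (ω ∩ ↑E)}) := by
    intro Φ
    have hdu : D ∩ (Hᶜ ∪ {ω | Φ (ω ∩ ↑E)}) = (Hᶜ ∩ D) ∪ (H ∩ (D ∩ {ω | Φ (ω ∩ ↑E)})) := by
      ext ω; simp only [Set.mem_union, Set.mem_compl_iff, Set.mem_inter_iff]; tauto
    have hdj : Disjoint (Hᶜ ∩ D) (H ∩ (D ∩ {ω | Φ (ω ∩ ↑E)})) :=
      Set.disjoint_left.2 fun ω hω hω' => hω.1 hω'.1
    have hD1 : D = {ω : Set (Sym2 V) | ¬(openGraph (ω ∩ ↑E)).Reachable a b} := hD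
    have i1 : μ.real (Hᶜ ∩ D) = (1 - γ) * μ.real D := by
      have := GZGluingLaw.real_inter_restrict w hdisj (fun η => ¬(openGraph η).Reachable a b) (fun η => s(u, c) ∉ η)
      have hHc : Hᶜ = {ω : Set (Sym2 V) | s(u, c) ∉ ω ∩ (↑({s(u, c)} : Finset (Sym2 V)) : Set (Sym2 V))} := by
        ext ω; simp [hH]
      rw [Set.inter_comm, hHc, hD1, hμ, this, ← hHc, ← hμ, hPHc, mul_comm]
    have i2 : μ.real (H ∩ (D ∩ {ω | Φ (ω ∩ ↑E)})) = γ * μ.real (D ∩ {ω | Φ (ω ∩ ↑E)}) := by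
      have e : D ∩ {ω | Φ (ω ∩ ↑E)} = {ω : Set (Sym2 V) | ¬(openGraph (ω ∩ ↑E)).Reachable a b ∧ Φ (ω ∩ ↑E)} := by
        ext ω; simp [hD1]
      rw [e]
      exact indep (fun η => ¬(openGraph η).Reachable a b ∧ Φ η)
    rw [hdu, measureReal_union hdj (hm _), i1, i2]
  -- the cells of the pendant-hub network
  have hz' : μ.real ((Hᶜ ∪ Au) ∩ (Hᶜ ∪ Bu)) = (1 - γ) + γ * μ.real (Au ∩ Bu) := by
    rw [← Set.union_inter_distrib_left]
    exact split (fun η => ¬(openGraph η).Reachable a u ∧ ¬(openGraph η).Reachable b u)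
  have hu' : μ.real (Hᶜ ∪ Au) = (1 - γ) + γ * μ.real Au := split (fun η => ¬(openGraph η).Reachable a u)
  have hv' : μ.real (Hᶜ ∪ Bu) = (1 - γ) + γ * μ.real Bu := split (fun η => ¬(openGraph η).Reachable b u)
  have hn' : μ.real (D ∩ ((Hᶜ ∪ Au) ∩ (Hᶜ ∪ Bu))) = (1 - γ) * μ.real D + γ * μ.real (D ∩ (Au ∩ Bu)) := by
    rw [← Set.union_inter_distrib_left]
    exact splitD (fun η => ¬(openGraph η).Reachable a u ∧ ¬(openGraph η).Reachable b u)
  have hθ' : μ.real Dᶜ = 1 - μ.real D := probReal_compl_eq_one_sub (hm _)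
  -- facts of the glued network with hub `u`
  obtain ⟨L, hn, hnz⟩ := GZSP.sp_facts w h hw
  obtain ⟨f1, f2, -, -, -, f6, -, -, -⟩ := GZGluingLaw.network_facts w (↑E : Set (Sym2 V)) (a := a) (b := b) hau rfl rfl rfl rfl
  -- `P(D) = P(D ∩ Au) + P(D ∩ Bu) − P(D ∩ Au ∩ Bu)` (if `a ↮ b` then `a ↮ u` or `b ↮ u`)
  have hDsplit : μ.real D = μ.real (D ∩ Au) + μ.real (D ∩ Bu) - μ.real (D ∩ Au ∩ Bu) := by
    have hDU : D = (D ∩ Au) ∪ (D ∩ Bu) := by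
      ext ω
      simp only [hD, hAu, hBu, Set.mem_inter_iff, Set.mem_union, Set.mem_setOf_eq]
      constructor
      · intro hab'
        by_cases hau' : (openGraph (ω ∩ (↑E : Set (Sym2 V)))).Reachable a u
        · exact Or.inr ⟨hab', fun hbu' => hab' (hau'.trans hbu'.symm)⟩
        · exact Or.inl ⟨hab', hau'⟩
      · rintro (⟨h1, -⟩ | ⟨h1, -⟩) <;> exact h1
    have hI : (D ∩ Au) ∩ (D ∩ Bu) = D ∩ Au ∩ Bu := by ext ω; simp only [Set.mem_inter_iff]; tauto
    have hie := measureReal_union_add_inter (hm (D ∩ Bu)) (μ := μ) (s := D ∩ Au)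
    rw [← hDU, hI] at hie
    linarith
  -- `P(a ↔ b off u) ≤ P(a ↔ b)`
  have hTD : μ.real Tu ≤ μ.real Dᶜ := by
    refine measureReal_mono (fun ω hω => ?_) (by finiteness)
    simp only [hTu, hD, Set.mem_setOf_eq, Set.mem_compl_iff, not_not] at hω ⊢
    exact hω.mono (openGraph_mono Set.sdiff_subset)
  -- the real step
  have key := pendant_of_facts (θ := 1 - μ.real D) (Θ := μ.real Tu)
    (W := μ.real (Au ∩ Bu) - μ.real (D ∩ Au ∩ Bu)) (C := μ.real (Au ∩ Bu) - μ.real Au * μ.real Bu)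
    (τ := (1 - μ.real D) - (μ.real (Au ∩ Bu) - μ.real (D ∩ Au ∩ Bu))) (γ := γ)
    (by linarith) f6 (by rw [← hθ']; exact hTD) rfl hγ0 hγ1 L
  -- assemble
  rw [hN', hA', hB', hT', hz', hu', hv', hn', hθ']
  have hDAB : D ∩ (Au ∩ Bu) = D ∩ Au ∩ Bu := (Set.inter_assoc _ _ _).symm
  rw [hDAB]
  have eW : (1 - γ) + γ * μ.real (Au ∩ Bu) - ((1 - γ) * μ.real D + γ * μ.real (D ∩ Au ∩ Bu)) =
      (1 - μ.real D) - γ * ((1 - μ.real D) - (μ.real (Au ∩ Bu) - μ.real (D ∩ Au ∩ Bu))) := by ring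
  have eC : (1 - γ) + γ * μ.real (Au ∩ Bu) - ((1 - γ) + γ * μ.real Au) * ((1 - γ) + γ * μ.real Bu) =
      γ * (1 - γ) * ((1 - μ.real D) - (μ.real (Au ∩ Bu) - μ.real (D ∩ Au ∩ Bu))) +
        γ ^ 2 * (μ.real (Au ∩ Bu) - μ.real Au * μ.real Bu) := by
    rw [f1, f2, hDsplit]; ring
  rw [eW, eC]
  exact key

end measure

end GZPendantHub

end Summit.CriticalPhenomena.PercolationContinuityZ3.Theorems
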